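import Literature.Analysis.FluidPDE.LerayHopfDatumTorus
import HarnessLib

/-!
# Re-basing the datum of a Leray–Hopf solution on the flat torus along a strong `L²` trace

Analysis/FluidPDE support file (theorem-only, all proved). The datum `u₀` of the accepted
`Torus.IsLerayHopfOn T ν f u₀ u` is an arbitrary function, seen only through the Bochner pairings
`∫ ⟪u₀, w⟫` (weak formulation, weak `L²` continuity), the kinetic energy `½∫‖u₀‖²` (energy
inequality from `0`) and the lower integral `eLpNorm (u t - u₀) 2` (strong initial trace); it
need not be a.e. strongly measurable (`LerayHopfDatumTorus`, module docstring). This file proves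
that every honest field `U₀ ∈ L²` which is ALSO a strong `L²` trace of the solution at `t = 0⁺`,
`‖u(t) - U₀‖₂ → 0`, is a datum of the same solution
(`Torus.IsLerayHopfOn.congr_datum_of_tendsto`, `Torus.IsGlobalLerayHopf.congr_datum_of_tendsto`),
and that an a.e. strongly measurable datum coincides with it a.e.
(`Torus.IsLerayHopfOn.datum_ae_eq_of_tendsto`). Ingredients:

* strong `L²` convergence moves `L²` pairings (`Torus.tendsto_integral_inner_of_tendsto_eLpNorm_sub`,
  Cauchy–Schwarz), so that `∫ ⟪u₀, w⟫ = ∫ ⟪U₀, w⟫` for every `w ∈ L²` — both are limits of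
  `∫ ⟪u(t), w⟫` (`Torus.IsLerayHopfOn.integral_inner_datum_eq_of_tendsto`); the weak formulation is
  then re-based by `Torus.IsWeakNSSolutionForcedOn.congr_datum_of_forall_integral_inner_eq`;
* the kinetic energy of the datum can only increase, `½∫‖u₀‖² ≤ ½∫‖U₀‖²`
  (`Torus.kineticEnergy_le_of_tendsto_eLpNorm_sub`): if `‖u₀‖²` is integrable then `‖u₀‖ ≤ ‖U₀‖`
  a.e. (`Torus.ae_norm_le_norm_of_tendsto_eLpNorm_sub`, comparing the MEASURABLE minorant
  `|‖u₀‖ - ‖u t‖| ≤ ‖u t - u₀‖` of the possibly non-measurable integrand), otherwise the energy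
  is the junk value `0`; so the energy inequality from `0` survives the re-basing.

Used by the `2½`-dimensional reduction of route `AnomalousDissipation/TwoAndHalfD`: the planar
section of an `x₃`-invariant datum on `T³` is an honest datum of the planar Leray–Hopf section.

## References

* G. P. Galdi, *An introduction to the Navier–Stokes initial-boundary value problem* (2000),
  Def. 2.1 (iv) (the datum is attained strongly in `L²`). [folklore]
* J. Leray, Acta Math. 63 (1934), §III.
-/

noncomputable section

open MeasureTheory TopologicalSpace Set Function Filter Topology
open scoped InnerProductSpace RealInnerProductSpace ENNReal NNReal

namespace Literature.Analysis.FluidPDE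

namespace Torus

/-! ### Strong `L²` convergence: pairings and pointwise norms -/

section General

variable {α : Type*} [MeasurableSpace α] {μ : Measure α}
  {G : Type*} [NormedAddCommGroup G] [InnerProductSpace ℝ G]

/-- Cauchy–Schwarz for the pairing of two fields: `‖∫ ⟪F, H⟫‖ₑ ≤ ‖F‖_{L²} ‖H‖_{L²}`. [folklore] -/
private theorem enorm_integral_inner_le_mul_eLpNorm_two {F H : α → G}
    (hF : AEStronglyMeasurable F μ) (hH : AEStronglyMeasurable H μ) :
    ‖∫ x, ⟪F x, H x⟫ ∂μ‖ₑ ≤ eLpNorm F 2 μ * eLpNorm H 2 μ := by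
  have h1 : ‖∫ x, ⟪F x, H x⟫ ∂μ‖ₑ ≤ ∫⁻ x, ‖F x‖ₑ * ‖H x‖ₑ ∂μ := by
    refine (enorm_integral_le_lintegral_enorm _).trans (lintegral_mono fun x => ?_)
    rw [← ofReal_norm, ← ofReal_norm, ← ofReal_norm, ← ENNReal.ofReal_mul (norm_nonneg _)]
    exact ENNReal.ofReal_le_ofReal (norm_inner_le_norm _ _)
  have h2 : ∫⁻ x, ‖F x‖ₑ * ‖H x‖ₑ ∂μ ≤
      (∫⁻ x, ‖F x‖ₑ ^ 2 ∂μ) ^ (1 / 2 : ℝ) * (∫⁻ x, ‖H x‖ₑ ^ 2 ∂μ) ^ (1 / 2 : ℝ) := by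
    have h := ENNReal.lintegral_mul_le_Lp_mul_Lq μ Real.HolderConjugate.two_two hF.enorm hH.enorm
    simpa only [Pi.mul_apply, ENNReal.rpow_two, one_div] using h
  have h3 : ∀ g : α → G, (∫⁻ x, ‖g x‖ₑ ^ 2 ∂μ) ^ (1 / 2 : ℝ) = eLpNorm g 2 μ := fun g => by
    rw [eLpNorm_eq_lintegral_rpow_enorm_toReal two_ne_zero ENNReal.ofNat_ne_top, ENNReal.toReal_ofNat]
    simp only [ENNReal.rpow_two]
  rw [← h3 F, ← h3 H]
  exact h1.trans h2

/-- **Strong `L²` convergence moves pairings**: if `‖g i - b‖_{L²} → 0` along `l`, with `g i`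
(eventually), `b` and `w` in `L²`, then `∫ ⟪g i, w⟫ → ∫ ⟪b, w⟫`. [folklore] -/
theorem tendsto_integral_inner_of_tendsto_eLpNorm_sub {ι : Type*} {l : Filter ι} {g : ι → α → G}
    {b w : α → G} (hb : MemLp b 2 μ) (hw : MemLp w 2 μ) (hg : ∀ᶠ i in l, MemLp (g i) 2 μ)
    (h : Tendsto (fun i => eLpNorm (g i - b) 2 μ) l (𝓝 0)) :
    Tendsto (fun i => ∫ x, ⟪g i x, w x⟫ ∂μ) l (𝓝 (∫ x, ⟪b x, w x⟫ ∂μ)) := by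
  rw [tendsto_iff_edist_tendsto_0]
  have hbound : ∀ᶠ i in l, edist (∫ x, ⟪g i x, w x⟫ ∂μ) (∫ x, ⟪b x, w x⟫ ∂μ) ≤
      eLpNorm (g i - b) 2 μ * eLpNorm w 2 μ := by
    filter_upwards [hg] with i hgi
    rw [edist_eq_enorm_sub, ← integral_sub (integrable_inner_of_memLp_two hgi hw)
      (integrable_inner_of_memLp_two hb hw)]
    have heq : (fun x => ⟪g i x, w x⟫ - ⟪b x, w x⟫) = fun x => ⟪(g i - b) x, w x⟫ := by
      funext x
      rw [Pi.sub_apply, inner_sub_left]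
    rw [heq]
    exact enorm_integral_inner_le_mul_eLpNorm_two (hgi.sub hb).1 hw.1
  refine tendsto_of_tendsto_of_tendsto_of_le_of_le' tendsto_const_nhds ?_
    (Eventually.of_forall fun _ => zero_le) hbound
  have := ENNReal.Tendsto.mul_const h (b := eLpNorm w 2 μ) (Or.inr hw.eLpNorm_ne_top)
  simpa only [zero_mul] using this

omit [InnerProductSpace ℝ G] in
/-- **Two strong `L²` limits have comparable norms a.e., even if one is not measurable.** If
`‖g i - a‖_{L²} → 0` and `‖g i - b‖_{L²} → 0` along a non-trivial filter, where the `g i`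
(eventually) and `b` are a.e. strongly measurable and only the NORM of `a` is, then `‖a‖ ≤ ‖b‖`
a.e.: the measurable function `(‖a‖ - ‖b‖)⁺` is dominated by `|‖a‖ - ‖g i‖| + ‖g i - b‖`, whose
first summand is a measurable minorant of the (possibly non-measurable) `‖g i - a‖`, so that its
`L²` norm is at most `‖g i - a‖₂ + ‖g i - b‖₂ → 0`. [folklore] -/
theorem ae_norm_le_norm_of_tendsto_eLpNorm_sub {ι : Type*} {l : Filter ι} [l.NeBot] {g : ι → α → G}
    {a b : α → G} (ha : AEStronglyMeasurable (fun x => ‖a x‖) μ) (hb : AEStronglyMeasurable b μ)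
    (hg : ∀ᶠ i in l, AEStronglyMeasurable (g i) μ)
    (h₁ : Tendsto (fun i => eLpNorm (g i - a) 2 μ) l (𝓝 0))
    (h₂ : Tendsto (fun i => eLpNorm (g i - b) 2 μ) l (𝓝 0)) :
    ∀ᵐ x ∂μ, ‖a x‖ ≤ ‖b x‖ := by
  obtain ⟨F, hF_def⟩ : ∃ F : α → ℝ, F = fun x => max (‖a x‖ - ‖b x‖) 0 := ⟨_, rfl⟩
  have hF : AEStronglyMeasurable F μ := by
    rw [hF_def]
    exact (ha.sub hb.norm).sup aestronglyMeasurable_const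
  have hbound : ∀ᶠ i in l, eLpNorm F 2 μ ≤ eLpNorm (g i - a) 2 μ + eLpNorm (g i - b) 2 μ := by
    filter_upwards [hg] with i hgi
    obtain ⟨A, hA_def⟩ : ∃ A : α → ℝ, A = fun x => ‖a x‖ - ‖g i x‖ := ⟨_, rfl⟩
    obtain ⟨B, hB_def⟩ : ∃ B : α → ℝ, B = fun x => ‖g i x‖ - ‖b x‖ := ⟨_, rfl⟩
    have hA : AEStronglyMeasurable A μ := by
      rw [hA_def]
      exact ha.sub hgi.norm
    have hB : AEStronglyMeasurable B μ := by
      rw [hB_def]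
      exact hgi.norm.sub hb.norm
    have h1 : eLpNorm F 2 μ ≤ eLpNorm (A + B) 2 μ := by
      refine eLpNorm_mono fun x => ?_
      have hAB : (A + B) x = ‖a x‖ - ‖b x‖ := by
        simp only [Pi.add_apply, hA_def, hB_def]
        ring
      have hFx : F x = max (‖a x‖ - ‖b x‖) 0 := by rw [hF_def]
      rw [hAB, hFx, Real.norm_eq_abs, Real.norm_eq_abs, abs_of_nonneg (le_max_right _ _)]
      exact max_le (le_abs_self _) (abs_nonneg _)
    have h2 : eLpNorm (A + B) 2 μ ≤ eLpNorm A 2 μ + eLpNorm B 2 μ := eLpNorm_add_le hA hB one_le_two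
    have h3 : eLpNorm A 2 μ ≤ eLpNorm (g i - a) 2 μ := by
      refine eLpNorm_mono fun x => ?_
      have hAx : A x = ‖a x‖ - ‖g i x‖ := by rw [hA_def]
      rw [hAx, Real.norm_eq_abs, Pi.sub_apply, ← norm_neg (g i x - a x), neg_sub]
      exact abs_norm_sub_norm_le (a x) (g i x)
    have h4 : eLpNorm B 2 μ ≤ eLpNorm (g i - b) 2 μ := by
      refine eLpNorm_mono fun x => ?_
      have hBx : B x = ‖g i x‖ - ‖b x‖ := by rw [hB_def]
      rw [hBx, Real.norm_eq_abs, Pi.sub_apply]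
      exact abs_norm_sub_norm_le (g i x) (b x)
    exact h1.trans (h2.trans (add_le_add h3 h4))
  have hlim : Tendsto (fun i => eLpNorm (g i - a) 2 μ + eLpNorm (g i - b) 2 μ) l (𝓝 0) := by
    simpa only [add_zero] using h₁.add h₂
  have hzero : eLpNorm F 2 μ = 0 := le_antisymm (ge_of_tendsto hlim hbound) bot_le
  have hae : F =ᵐ[μ] 0 := (eLpNorm_eq_zero_iff hF two_ne_zero).1 hzero
  filter_upwards [hae] with x hx
  have hx' : max (‖a x‖ - ‖b x‖) 0 = 0 := by
    have h0 : F x = 0 := hx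
    rwa [hF_def] at h0
  linarith [le_max_left (‖a x‖ - ‖b x‖) 0]

end General

/-! ### The kinetic energy of a strong `L²` trace dominates that of any other trace -/

variable {d : Type*} [Fintype d] [DecidableEq d]

omit [DecidableEq d] in
/-- **The kinetic energy of the datum can only increase under re-basing.** If `‖g i - a‖₂ → 0`
and `‖g i - b‖₂ → 0` along a non-trivial filter with `g i` (eventually) measurable and `b ∈ L²`,
then `½∫‖a‖² ≤ ½∫‖b‖²` for an ARBITRARY function `a`: if `‖a‖²` is integrable then `‖a‖ ≤ ‖b‖`
a.e. (`ae_norm_le_norm_of_tendsto_eLpNorm_sub`), otherwise the left side is the junk value `0`. [folklore] -/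
theorem kineticEnergy_le_of_tendsto_eLpNorm_sub {ι : Type*} {l : Filter ι} [l.NeBot]
    {g : ι → UnitAddTorus d → EuclideanSpace ℝ d} {a b : UnitAddTorus d → EuclideanSpace ℝ d}
    (hb : MemLp b 2 volume) (hg : ∀ᶠ i in l, AEStronglyMeasurable (g i) volume)
    (h₁ : Tendsto (fun i => eLpNorm (g i - a) 2 volume) l (𝓝 0))
    (h₂ : Tendsto (fun i => eLpNorm (g i - b) 2 volume) l (𝓝 0)) :
    FunctionSpaces.Torus.kineticEnergy a ≤ FunctionSpaces.Torus.kineticEnergy b := by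
  unfold FunctionSpaces.Torus.kineticEnergy
  refine mul_le_mul_of_nonneg_left ?_ (by norm_num)
  by_cases hi : Integrable (fun x => ‖a x‖ ^ 2) volume
  · have ha : AEStronglyMeasurable (fun x => ‖a x‖) volume := by
      have heq : (fun x => ‖a x‖) = fun x => Real.sqrt (‖a x‖ ^ 2) :=
        funext fun x => (Real.sqrt_sq (norm_nonneg _)).symm
      rw [heq]
      exact Real.continuous_sqrt.comp_aestronglyMeasurable hi.1
    have hae := ae_norm_le_norm_of_tendsto_eLpNorm_sub ha hb.1 hg h₁ h₂
    refine integral_mono_ae hi (hb.integrable_norm_pow two_ne_zero) ?_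
    filter_upwards [hae] with x hx
    exact pow_le_pow_left₀ (norm_nonneg _) hx 2
  · rw [integral_undef hi]
    exact integral_nonneg fun _ => sq_nonneg _

/-! ### Re-basing the datum of a Leray–Hopf solution -/

variable {T ν : ℝ} {f u : ℝ → UnitAddTorus d → EuclideanSpace ℝ d}
  {u₀ U₀ : UnitAddTorus d → EuclideanSpace ℝ d}

/-- **A strong `L²` trace has the pairings of the datum**: if `u` is Leray–Hopf on `[0, T)`,
`T > 0`, with datum `u₀`, and `‖u(t) - U₀‖₂ → 0` as `t → 0⁺` for some `U₀ ∈ L²`, then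
`∫ ⟪u₀, w⟫ = ∫ ⟪U₀, w⟫` for every `w ∈ L²` (both are the limit of `∫ ⟪u(t), w⟫`). [folklore] -/
theorem IsLerayHopfOn.integral_inner_datum_eq_of_tendsto (h : IsLerayHopfOn T ν f u₀ u) (hT : 0 < T)
    (hU₀ : MemLp U₀ 2 volume) (hlim : Tendsto (fun t => eLpNorm (u t - U₀) 2 volume) (𝓝[>] 0) (𝓝 0))
    {w : UnitAddTorus d → EuclideanSpace ℝ d} (hw : MemLp w 2 volume) :
    ∫ x, ⟪u₀ x, w x⟫ = ∫ x, ⟪U₀ x, w x⟫ := by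
  have h1 := (h.weak_continuous w hw).2
  have hev : ∀ᶠ t in 𝓝[>] (0 : ℝ), MemLp (u t) 2 volume := by
    filter_upwards [Ioo_mem_nhdsGT hT] with t ht
    exact h.memLp t (Ioo_subset_Icc_self ht)
  have h2 := tendsto_integral_inner_of_tendsto_eLpNorm_sub hU₀ hw hev hlim
  exact tendsto_nhds_unique h1 h2

/-- **Re-basing the datum along a strong `L²` trace.** If `u` is a Leray–Hopf solution on
`[0, T)`, `T > 0`, with datum `u₀`, and `U₀ ∈ L²` satisfies `‖u(t) - U₀‖₂ → 0` as `t → 0⁺`, then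
`u` is a Leray–Hopf solution on `[0, T)` with datum `U₀`: the weak formulation and the weak `L²`
limit at `0⁺` only see the pairings `∫ ⟪u₀, w⟫ = ∫ ⟪U₀, w⟫`
(`integral_inner_datum_eq_of_tendsto`), the energy inequality from `0` survives because
`½∫‖u₀‖² ≤ ½∫‖U₀‖²` (`kineticEnergy_le_of_tendsto_eLpNorm_sub` with the two strong traces), and
the strong initial trace is the hypothesis (Galdi 2000, Def. 2.1). [folklore] -/
theorem IsLerayHopfOn.congr_datum_of_tendsto (h : IsLerayHopfOn T ν f u₀ u) (hT : 0 < T)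
    (hU₀ : MemLp U₀ 2 volume) (hlim : Tendsto (fun t => eLpNorm (u t - U₀) 2 volume) (𝓝[>] 0) (𝓝 0)) :
    IsLerayHopfOn T ν f U₀ u where
  weak := h.weak.congr_datum_of_forall_integral_inner_eq
    fun _ hw => h.integral_inner_datum_eq_of_tendsto hT hU₀ hlim hw
  energy_bound := h.energy_bound
  memLp := h.memLp
  memL2Sobolev := h.memL2Sobolev
  energy_ineq_zero t ht := by
    have hev : ∀ᶠ s in 𝓝[>] (0 : ℝ), AEStronglyMeasurable (u s) volume := by
      filter_upwards [Ioo_mem_nhdsGT hT] with s hs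
      exact (h.memLp s (Ioo_subset_Icc_self hs)).1
    have hE := kineticEnergy_le_of_tendsto_eLpNorm_sub hU₀ hev h.strong_initial hlim
    exact (h.energy_ineq_zero t ht).trans (by linarith)
  energy_ineq_ae := h.energy_ineq_ae
  weak_continuous w hw := by
    refine ⟨(h.weak_continuous w hw).1, ?_⟩
    rw [← h.integral_inner_datum_eq_of_tendsto hT hU₀ hlim hw]
    exact (h.weak_continuous w hw).2
  strong_initial := hlim

/-- **Re-basing the datum of a global Leray–Hopf solution along a strong `L²` trace.** [folklore] -/
theorem IsGlobalLerayHopf.congr_datum_of_tendsto (h : IsGlobalLerayHopf ν f u₀ u)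
    (hU₀ : MemLp U₀ 2 volume) (hlim : Tendsto (fun t => eLpNorm (u t - U₀) 2 volume) (𝓝[>] 0) (𝓝 0)) :
    IsGlobalLerayHopf ν f U₀ u :=
  fun T hT => (h T hT).congr_datum_of_tendsto hT hU₀ hlim

/-- **A measurable datum is the strong trace**: if `u` is Leray–Hopf on `[0, T)`, `T > 0`, with an
a.e. strongly measurable datum `u₀`, and `‖u(t) - U₀‖₂ → 0` as `t → 0⁺` with `U₀` a.e. strongly
measurable, then `u₀ = U₀` a.e. (`‖u₀ - U₀‖₂ ≤ ‖u(t) - u₀‖₂ + ‖u(t) - U₀‖₂ → 0`). [folklore] -/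
theorem IsLerayHopfOn.datum_ae_eq_of_tendsto (h : IsLerayHopfOn T ν f u₀ u) (hT : 0 < T)
    (hu₀ : AEStronglyMeasurable u₀ volume) (hU₀ : AEStronglyMeasurable U₀ volume)
    (hlim : Tendsto (fun t => eLpNorm (u t - U₀) 2 volume) (𝓝[>] 0) (𝓝 0)) :
    u₀ =ᵐ[volume] U₀ := by
  have hbound : ∀ᶠ t in 𝓝[>] (0 : ℝ),
      eLpNorm (u₀ - U₀) 2 volume ≤ eLpNorm (u t - u₀) 2 volume + eLpNorm (u t - U₀) 2 volume := by
    filter_upwards [Ioo_mem_nhdsGT hT] with t ht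
    have hut : AEStronglyMeasurable (u t) volume := (h.memLp t (Ioo_subset_Icc_self ht)).1
    have hsplit : u₀ - U₀ = (u t - U₀) - (u t - u₀) := by
      funext x
      simp only [Pi.sub_apply]
      abel
    rw [hsplit, add_comm]
    exact eLpNorm_sub_le (hut.sub hU₀) (hut.sub hu₀) one_le_two
  have hl : Tendsto (fun t => eLpNorm (u t - u₀) 2 volume + eLpNorm (u t - U₀) 2 volume)
      (𝓝[>] 0) (𝓝 0) := by
    simpa only [add_zero] using h.strong_initial.add hlim
  have hzero : eLpNorm (u₀ - U₀) 2 volume = 0 := le_antisymm (ge_of_tendsto hl hbound) bot_le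
  have hae := (eLpNorm_eq_zero_iff (hu₀.sub hU₀) two_ne_zero).1 hzero
  filter_upwards [hae] with x hx
  exact sub_eq_zero.1 hx

/-- Global form of `IsLerayHopfOn.datum_ae_eq_of_tendsto`. [folklore] -/
theorem IsGlobalLerayHopf.datum_ae_eq_of_tendsto (h : IsGlobalLerayHopf ν f u₀ u)
    (hu₀ : AEStronglyMeasurable u₀ volume) (hU₀ : AEStronglyMeasurable U₀ volume)
    (hlim : Tendsto (fun t => eLpNorm (u t - U₀) 2 volume) (𝓝[>] 0) (𝓝 0)) :
    u₀ =ᵐ[volume] U₀ :=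
  (h 1 one_pos).datum_ae_eq_of_tendsto one_pos hu₀ hU₀ hlim

end Torus

end Literature.Analysis.FluidPDE

end
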